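import Summits.CriticalPhenomena.SAWScalingLimit.Theorems.SAWRenewalTightnessTubeLowerBoundDefs
import Summits.CriticalPhenomena.SAWScalingLimit.Theorems.SAWRenewalTightnessTubeLowerBoundQuarterFlux
import Summits.CriticalPhenomena.SAWScalingLimit.Theorems.SAWRenewalTightnessTubeLowerBoundDominoFloor
import Summits.CriticalPhenomena.SAWScalingLimit.Theorems.SAWRenewalTightnessTubeLowerBoundSteeredChain
import Summits.CriticalPhenomena.SAWScalingLimit.Theorems.SAWRenewalTightnessTubeLowerBoundMirrorPin
import Summits.CriticalPhenomena.SAWScalingLimit.Theorems.SAWRenewalTightnessTubeLowerBoundOctantReduction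
import Summits.CriticalPhenomena.SAWScalingLimit.Theorems.SAWRenewalTightnessTubeLowerBoundCornerStaircase
import Summits.CriticalPhenomena.SAWScalingLimit.Theorems.SAWRenewalTightnessTubeLowerBoundCornerWindows
import Summits.CriticalPhenomena.SAWScalingLimit.Theorems.TubeLowerBound.Negative.TubeLowerBoundFixedWidth

/-!
# Line `lieb-simon-star` — skeleton for the crux `SAWRenewalTightness.TubeLowerBound`
(LEAD c1, prover-line-stmt-CriticalPhenomena-4730-c1-0, 2026-08-16: all stubs but S1 LANDED and wired in by name; only `stub_cornerCrossingFloor` carries a `sorry`.  LEAD RESHAPE r2, prover-line-stmt-CriticalPhenomena-4730-0: S4 split into S4a `stub_octantReduction`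
(dihedral + translation transport, M) and S4b `stub_cornerStaircase` (the staircase for `0 ≤ b ≤ a`, L) through the new
statement `FirstOctantTubeFloor`; the Simon–Lieb milestones `QuarterFlux` / `DominoFloor` are REGISTERED as
`stub_quarterFlux` / `stub_dominoFloor` and consumed by the by-product theorem `dominoFloor_holds` (not by
`TubeLowerBound_of`): 7 stubs, composition unchanged in spirit — S1 → S2 → S3 → S4b → S4a → crux by name.)
(crux item stmt-CriticalPhenomena-4730, rank 4 of `route-CriticalPhenomena-SAWRenewalTightness`; crux-plan round 1;
idea card `Cruxes/TubeLowerBound/Ideas/lieb-simon-star.md` (merged by the panel with `simon-lieb-mirror-fan`);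
triage r1-2: pass, r1-3: pass — sharpenings answered in `Lines/lieb-simon-star.md`)

Crux (FIXED, by name): `TubeLowerBound` — there are `C` and `c > 0` such that for all `u v ∈ ℤ²` and `ℓ ≥ 1` with
`|u − v| ≤ ℓ` some partial sum of the `x_c`-mass of self-avoiding walks `u → v` whose vertices stay within `ℓ/10 + 2`
of the segment `[u, v]` is `≥ c ℓ^{−C}`.  ALL directions `v − u`.

## The line (4 registered stubs, glued by the kernel-checked `TubeLowerBound_of`)

The idea card has two halves.  (i) The Simon–Lieb half — `θ_S(x_c) ≥ 1` for every finite `S ∋ 0`, a quarter of it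
through each side of a centred box, and the reflect-and-Schwarz DOMINO floor — is a set of THEOREMS (triage r1-2/r1-3
checked them by hand and numerically); they are typed below as MILESTONES (`LiebSimonFloor`, `QuarterFlux`,
`DominoFloor`), not registered: a bulk star occupies a full box around its endpoint, so it cannot sit at a corner of a
staircase (it meets the next piece) and no lattice symmetry isolates a sub-side of it — no all-direction composition can
consume the stars (planner's NOTES, "Design decision").  (ii) The card's reduction "thin tube ⇐ ONE rectangle-crossing
floor by a rectangle chain + one Schwarz about the bisector" is what this skeleton builds, with two sharpenings that make
it reach EVERY direction and weaken its input:

* S1 `stub_cornerCrossingFloor` (OPEN, HARDEST — the RSW-type input; the card's `RectCrossingFloor` with the entry point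
  weakened from "uniform over the west side, corners included" to "the CORNER only", and the aspect made existential):
  `∃ K C c, ∀ a ≥ 1`: the `x_c`-mass of SAWs from the south-west corner `(0,0)` of the closed rectangle
  `[0, a] × [0, K a]` that stay in it and whose last vertex lies on the east column `x = a` is `≥ c a^{−C}` (some
  partial sum).  Point-to-LINE, one scale, one direction, no second endpoint, aspect free; predicted `≍ a^{−7/8}`
  (π/2-corner boundary exponent `5/4` + far-side exponent `5/8`, Cardy 1984); not implied by the crux (lateral transfer,
  triage r1-3 CORRECTION) and not finitely refutable.
* S2 `stub_steeredChain` (provable now, M–L): S1 ⇒ `OneSidedReach` — from the corner of the FLAT box `[0, X] × [0, X/5]`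
  to its east column, `≥ c X^{−C}`, for every `X ≥ 1`.  Mechanism (ONE-SIDED SIGN STEERING, the new device): chain
  `k = 10K + 1` rectangles of widths `a` or `a + 1` eastwards, consecutive rectangles in disjoint column ranges joined by one
  east edge; rectangle `i` is placed with the current point at its SW corner if the current height `y < H_i = K a_i`,
  else at its NW corner (the NW family is the `y ↦ −y` mirror of the SW family, same mass): heights never leave
  `[0, 2K(a+1)] ⊆ [0, X/5]`, the chain never dips below its starting row, and the mass multiplies
  (`≥ x_c^{k−1} ∏ c a_i^{−C}`), `k` FIXED because heights scale with widths — exactly the widening that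
  `Negative.not_withoutDist` demands.  Widths `a`/`a+1` realise every `X ≥ 2k − 1`; smaller `X`: the straight walk.
* S3 `stub_mirrorPin` (provable now, M): `OneSidedReach` ⇒ `HalfTubePieceFloor` — POINTWISE corner-to-corner pieces:
  SAWs `(0,0) → (L,0)` inside the closed half-tube `[0, L] × [0, L/10]`, `≥ c L^{−C}` for every `L ≥ 1`.  Mechanism
  (Madras–Slade Lemma 4.1.12, reflect-and-Schwarz, applied ONCE): a one-sided half-walk to column `X`, one (odd `L`) or
  two (even `L`) bridging edges, and the reversed mirror image in `x = L/2` of a second half-walk with the SAME end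
  height; halves live in disjoint column ranges (self-avoiding, injective), Cauchy–Schwarz over the `⌊X/5⌋ + 1 ≤ X + 1`
  end heights: `mass(L) ≥ x_c² (c X^{−C})² / (X + 1)`.
* S4 `stub_cornerStaircase` (provable now, L): `HalfTubePieceFloor` ⇒ `TightTubeFloor` (the crux at its own scale
  `ℓ₀ = max(1, |u − v|)`, all directions).  Mechanism (FREE CORNERS FOR ONE-SIDED FLAT PIECES — refines triage F1, which
  granted free corners to tapered pieces only): WLOG `u = 0`, `v = (a, b)`, `0 ≤ b ≤ a` (dihedral symmetry + translation);
  `n = 20` rounds through the lattice points `Q_j = (⌊ja/n⌋, ⌊jb/n⌋)`: a horizontal piece ABOVE its leg from `Q_{j−1}`,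
  one east edge, a vertical piece (coordinate swap of a horizontal one) to the RIGHT of its leg, one north edge to `Q_j`.
  Every horizontal piece lies in columns `[x_{j−1}, x_j − 1]`, every vertical one in columns `[x_j, x_{j+1} − 1]` and rows
  `[y_{j−1}, y_j − 1]`, the next horizontal one in rows `≥ y_j`: all pieces are pairwise disjoint by column or row
  separation, so the concatenation is self-avoiding and injective (corners are prescribed lattice points).  Tube: vertical
  distance to the segment `≤ 1.1 a/n + 1 ≤ |v|/10 + 2`.  Mass `≥ (x_c min(c,1))^{2n} (2ℓ₀)^{−2nC}`.  Small `a < n`: the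
  digital staircase (distance `< 2`, mass `x_c^{a+b}`).
* `TubeLowerBound_of : TubeLowerBound` — kernel-checked composition (no `sorry` of its own): S1–S4 give `TightTubeFloor`,
  and monotonicity in `ℓ` (the tube only widens, `c ℓ^{−C}` only shrinks for `C ≥ 0`) gives the crux BY NAME.

Every stub is stated over TREE VOCABULARY plus the local `def`s of this file (`Zd.saws`, `Zd.sawFun`,
`criticalFugacity`, `Site.toComplex`), all floors in the `∃ N` partial-sum form with `0 ≤ C`.

Disproof.lean (cdisprove cycle 1; landed as `Theorems/TubeLowerBound/Negative/TubeLowerBoundLoadBearing|FixedWidth`,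
both IMPORTED here) honoured: `not_atFugacity_of_lt` (criticality load-bearing) — the line uses `x = x_c` at S1 only
(S2–S4 are fugacity-free injections, valid at any fugacity in `(0,1]`; the corner-crossing floor is false below `x_c` by
the refuter's own exponential decay); `not_withoutDist` (the tube must WIDEN) — used at S2 (rectangle heights `K a_i`
scale with the widths, so `k` is a constant; at fixed height the same chain needs `k ∝ X` pieces and decays exponentially,
the refuter's strip regime `m_W (W+1) ≈ π·5/8`) and at S3/S4 (piece heights `L/10`); `not_withoutSlack` — the `+2` is
kept in `TightTubeFloor` and spent on lattice rounding (`+1`) and the digital path (`< 2`); `constraints` /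
`exponent_eq_zero_of_withoutOneLe` — every def carries `0 ≤ C`, `TightTubeFloor` works at `ℓ₀ ≥ 1`; `not_allN` — `∃ N`
throughout; `twoPoint_floor` — consistent: `HalfTubePieceFloor` is a (confined) pointwise axis two-point floor, claimed
only downstream of the open S1.  No stub is an instance of a refuted variant (`examples` at the end of the file record the
two landed Negative modules the stubs were checked against); `ledger negatives --problem CriticalPhenomena`: nothing on
tube / two-point / crossing floors.
-/

noncomputable section

namespace Summit.CriticalPhenomena.SAWScalingLimit.Cruxes.TubeLowerBound.LiebSimonStar

open scoped BigOperators Classical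
open Literature.Probability.LatticeModels
open Literature.Probability.RandomPlanarGeometry Literature.Probability.RandomPlanarGeometry.SAW
open Summit.CriticalPhenomena.SAWScalingLimit.Theses.SAWRenewalTightness
open Summit.CriticalPhenomena.SAWScalingLimit.Theorems.TubeLowerBound.LiebSimonStar

set_option linter.unusedVariables false

/-! ## The statements of the line

LEAD RESHAPE r2: the statements `CornerCrossingFloor`, `OneSidedReach`, `HalfTubePieceFloor`, `FirstOctantTubeFloor`,
`TightTubeFloor`, `supNorm`, `LiebSimonFloor`, `QuarterFlux`, `DominoFloor` now live in the LANDED module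
`Summits/CriticalPhenomena/SAWScalingLimit/Theorems/SAWRenewalTightnessTubeLowerBoundDefs.lean` (p76932, namespace
`Summit.CriticalPhenomena.SAWScalingLimit.Theorems.TubeLowerBound.LiebSimonStar`, opened above), together with the
registered sub-goal `tightTubeFloor_iff_crux : TightTubeFloor ↔ TubeLowerBound`; the stub files import that module and
prove the stubs below BY NAME. -/

/-! ## Registered stubs (`sorry` only here) -/

/-- **S1 `stub_cornerCrossingFloor`** — `CornerCrossingFloor` (see the def): the HARDEST stub, the whole open content of
the line (an RSW-type polynomial LOWER bound at `x_c` for a corner-started, rectangle-confined point-to-line family).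
Attack surfaces recorded for the lead: (a) monotonicity — the family grows with `K`, and appending one east step shows
the floor is needed only on a set of widths with bounded gaps; (b) its quadrant shadow (drop the height cap) is a
"quadrant bridge" class with a cone-nesting monoid structure (`wedge-bridge-monoid`, quadrant chart `f^Q`), so
supermultiplicativity in `a` is available there; (c) the Simon–Lieb milestones give the corner-to-ANY-side escape mass of
every box cornered at `0` only together with the near sides, i.e. no floor — the honest wall of the idea.  Cheapest
falsifier: none finite (an `∃ C` asymptotic floor); sanity numerics = corner-vs-mid-side entry ratio of square crossings,
predicted `≍ a^{−5/8}` (card, falsifier (b)). -/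
theorem stub_cornerCrossingFloor : CornerCrossingFloor := by
  sorry

/-- **S2 `stub_steeredChain`** — `CornerCrossingFloor → OneSidedReach` (one-sided sign steering; provable now, M–L).
Given `(K, C, c)` from S1 put `k := 10 K + 1`.  (1) SYMMETRY: the `y ↦ −y` image (`Zd.reflAt 1 0`) of S1's family is the
family of SAWs from the NORTH-west corner of `[0, a] × [−K a, 0]` ending on `x = a`, with the same partial sums.
(2) CHAIN: for widths `a_1, …, a_k ∈ {a, a+1}` define recursively the family of walks
`ω_1 · e₁ · ω_2 · e₁ ⋯ e₁ · ω_k` where `ω_i` runs in the rectangle of width `a_i`, height `K a_i`, west column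
`x_i = Σ_{j<i} (a_j + 1)`, placed with the current point `P` (the start `0`, resp. the east neighbour of the previous
exit point) at its SW corner if `P_y < K a_i` and at its NW corner otherwise: by induction every height stays in
`[0, 2K(a+1)]`, every vertex has `0 ≤ x ≤ X := Σ_i (a_i + 1) − 1`, consecutive pieces occupy the disjoint column ranges
`[x_i, x_i + a_i]`, so `Zd.concatWalk_mem_saws` applies (separation by columns), the map from tuples to chains is
injective (cut at the first visits to the columns `x_i`), and summing the floors from the inside out gives partial mass
`≥ x_c^{k−1} ∏_i c a_i^{−C} ≥ x_c^{k−1} c^k (a+1)^{−kC}` at `N = Σ N(a_i) + k − 1`.  (3) FIT: `5 · 2K(a+1) ≤ X` because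
`X ≥ k a + k − 1 = 10K(a+1) + a`; and `X` ranges over `[k(a+1) − 1, k(a+2) − 1]` as the widths vary, which for
`a = 1, 2, …` covers every `X ≥ 2k − 1`; for `1 ≤ X < 2k − 1` the straight walk (`Zd.straightWalk`) has mass `x_c^X`.
Output constants: `C' = kC`, `c' = min (x_c^{2k}) (x_c^{k−1} c^k 2^{−kC})` (using `a + 1 ≤ X + 1 ≤ 2X`). -/
theorem stub_steeredChain : CornerCrossingFloor → OneSidedReach :=
  Summit.CriticalPhenomena.SAWScalingLimit.Theorems.TubeLowerBound.LiebSimonStar.stub_steeredChain  -- LANDED (wave 1)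

/-- **S3 `stub_mirrorPin`** — `OneSidedReach → HalfTubePieceFloor` (reflect-and-Schwarz, Madras–Slade Lemma 4.1.12,
applied once; provable now, M).  Given `(C, c)` and `L ≥ 3`, write `L = 2X + 1` or `L = 2X + 2` with `X ≥ 1`.  For
half-walks `ω, ω'` in the `OneSidedReach` family at `X` with the SAME end height `y` (`0 ≤ y ≤ X/5`), the walk `ω`, the
bridging edge(s) `(X, y) → (X+1, y)` (`→ (X+2, y)` for even `L`), then the time-reversed mirror image of `ω'` under
`x ↦ L − x` (`Zd.reflAt 0 L`) is a self-avoiding walk `0 → (L, 0)` (the halves live in the columns `[0, X]` and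
`[L − X, L]`, disjoint), all of whose vertices satisfy `0 ≤ x ≤ L`, `0 ≤ y`, `10 y ≤ 2X ≤ L`; the map `(ω, ω') ↦` glued
walk is injective (cut at the unique crossing of the gap).  Hence, with `A(y)` the partial mass of half-walks ending at
height `y`, the piece mass at `N = 2N_X + 2` is `≥ x_c² Σ_y A(y)² ≥ x_c² (Σ_y A(y))² / (⌊X/5⌋ + 1)`
(`sq_sum_le_card_mul_sum_sq`) `≥ x_c² c² X^{−2C} / (X + 1) ≥ x_c² c² L^{−(2C+1)} / 1` up to the constant from
`L/3 ≤ X ≤ L`.  `L = 1, 2`: the straight walk, mass `x_c^L`.  Output: `C' = 2C + 1`, `c' = min (x_c²) (x_c² c² 3^{−2C}/2)`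
(any such bookkeeping; `x_c ≤ 1` by `Zd.one_le_connectiveConstant`). -/
theorem stub_mirrorPin : OneSidedReach → HalfTubePieceFloor :=
  Summit.CriticalPhenomena.SAWScalingLimit.Theorems.TubeLowerBound.LiebSimonStar.stub_mirrorPin  -- LANDED (wave 1)

/-- **S4b `stub_cornerStaircase`** — `HalfTubePieceFloor → FirstOctantTubeFloor` (free corners for one-sided flat
pieces; lattice geometry, provable now, L).  For `v = (a, b)` with naturals `b ≤ a` put `d = |v| = √(a²+b²) ∈ [a, a√2]`,
`ℓ₀ = max 1 d`.  (1) SMALL CASE `a < n := 20`: the digital staircase `x ↦ (x, round(b x / a))` refined to unit steps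
(for `a = 0`: the 0-step walk) is a self-avoiding lattice path `0 → v` of `a + b` steps every vertex of which is within
vertical distance `3/2 < 2` of the segment; its mass is `x_c^{a+b} ≥ x_c^{2n}` (one term of the double sum, all terms
are nonnegative).  (2) STAIRCASE `a ≥ n`: corners `Q_j = (x_j, y_j) := (⌊j a/n⌋, ⌊j b/n⌋)`, `j = 0..n` (`Δx_j ≥ 1`,
`0 ≤ Δy_j ≤ Δx_j + 1`); round `j`: a HORIZONTAL piece of length `Δx_j − 1` from `Q_{j−1}` (a `HalfTubePieceFloor` walk
translated by `Q_{j−1}`: columns `[x_{j−1}, x_j − 1]`, rows `[y_{j−1}, y_{j−1} + (Δx_j−1)/10]`), the east edge to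
`R_j = (x_j, y_{j−1})`, then, if `Δy_j ≥ 1`, a VERTICAL piece of length `Δy_j − 1` from `R_j` (the image of a
`HalfTubePieceFloor` walk under the coordinate swap `(x,y) ↦ (y,x)`, translated by `R_j`: columns
`[x_j, x_j + (Δy_j − 1)/10]`, rows `[y_{j−1}, y_j − 1]`) and the north edge to `Q_j` (pieces of length `0` are single
points; if `Δy_j = 0` then `R_j = Q_j` and round `j` ends at `R_j`).  DISJOINTNESS: horizontal pieces of different rounds
are separated by columns (`H_j ⊆` columns `[x_{j−1}, x_j − 1]`); `V_j ⊆` columns `[x_j, x_j + (Δy_j−1)/10]` and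
`(Δy_j − 1)/10 < 1 ≤ Δx_{j+1}` fails only if `Δy_j ≥ 11`, in which case still `(Δy_j−1)/10 ≤ (Δx_{j+1}+1)/10 < Δx_{j+1}`
(`b ≤ a` gives `Δy_j ≤ Δx_{j+1} + 2`... use `Δy_j ≤ ⌈b/n⌉ ≤ ⌈a/n⌉ ≤ Δx_{j+1} + 1`), hence `V_j` is column-separated from
`H_j`, from every later vertical piece and from every `H_k`, `k ≥ j + 2`; from `H_{j+1}` (columns `≥ x_j`, rows `≥ y_j`)
it is separated by rows (`V_j` rows `≤ y_j − 1`).  So the concatenation (`Zd.concatWalk`, `concatWalk_mem_saws`, or a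
direct induction) is a SAW `0 → v`, and the construction is injective (corners are prescribed lattice points, each
visited once: cut at the first visits to `R_j`, `Q_j`).  TUBE: for a vertex `p` on `H_j` or `V_j` take
`q = (p_x, b p_x / a) ∈ [0, v]` (`0 ≤ p_x ≤ a`); `|p − q| = |a p_y − b p_x| / a ≤ 1.1 a/n + 1 ≤ d/10 + 2` for `n = 20`
(`Metric.infDist_le_dist_of_mem`; on `H_j`: `0 ≤ p_y − y_{j−1} ≤ (a/n)/10` and `|b x − a y_{j−1}| ≤ a b/n + a` for
`x ∈ [x_{j−1}, x_j]`; on `V_j`: `p_x ≤ x_j + b/(10 n) + 1`, `y_{j−1} ≤ p_y ≤ y_j`).  MASS: `≤ 2n` pieces of length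
`≤ a/n + 1 ≤ d`, each of partial mass `≥ min(c,1) d^{−C}` (monotonicity of `L ↦ c L^{−C}`, `C ≥ 0`), and `≤ 2n` connector
edges: partial mass `≥ (x_c min(c,1))^{2n} d^{−2nC}` at `N = Σ N_pieces + 2n`.  Output: `C' = 2nC`,
`c' = (x_c min(c,1))^{2n}` (covers the small case too, `ℓ₀^{−C'} ≤ 1`). -/
theorem stub_cornerStaircase : HalfTubePieceFloor → FirstOctantTubeFloor :=
  Summit.CriticalPhenomena.SAWScalingLimit.Theorems.TubeLowerBound.LiebSimonStar.stub_cornerStaircase  -- LANDED (p83800)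

/-- **S4a `stub_octantReduction`** — `FirstOctantTubeFloor → TightTubeFloor` (symmetry transport; provable now, M).
(1) TRANSLATION: the double sum of `TightTubeFloor` at `(u, v)` equals the one of `FirstOctantTubeFloor`'s shape at
`(0, v − u)`: the family is literally `sawFun 2 n (v − u)` and `Site.toComplex (u + ω i) = Site.toComplex u +
Site.toComplex (ω i)` (`Site.toComplex` is additive: `toComplex_re/_im`, `Pi.add_apply`, `Int.cast_add`), while
`Metric.infDist (z + p) ((z + ·) '' S) = Metric.infDist p S` (`Metric.infDist_image` for the isometry `(z + ·)`, or
`EMetric.infEdist_add`-type lemmas) with `(z + ·) '' segment ℝ 0 w = segment ℝ z (z + w)` (`segment_translate_image`)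
and `dist (z) (z + w) = dist 0 w`.  (2) DIHEDRAL: for `w : Site 2` there is one of the 8 coordinate isometries `g`
(compositions of the swap `(x, y) ↦ (y, x)` and the sign changes `x ↦ −x`, `y ↦ −y`) with `g w = (a, b)`,
`a = max |w 0| |w 1| ≥ b = min |w 0| |w 1| ≥ 0`; `ω ↦ g ∘ ω` is a bijection `Zd.sawFun 2 n w ≃ Zd.sawFun 2 n (g w)`
(adjacency and injectivity are preserved: `Zd.zdGraph_adj_iff_sub`, cf. `Zd.neg_mem_sawFun`, `Zd.reflAt`,
`zdGraph_adj_reflAt`), and `Site.toComplex ∘ g = T ∘ Site.toComplex` for a real-linear isometry `T` of `ℂ` fixing `0`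
(`conj`, `z ↦ −z`, `z ↦ I * conj z`, …), so `T '' segment ℝ 0 (toComplex w) = segment ℝ 0 (toComplex (g w))`
(`image_segment` for linear maps), `infDist (T p) (T '' S) = infDist p S` and `dist 0 (T z) = dist 0 z`; hence the
double sums and the radii at `(0, w)` and `(0, g w)` agree term by term (`Finset.sum_equiv` / `Finset.sum_bij`).
(3) Apply `FirstOctantTubeFloor` at `(a, b)` (as naturals, `Int.toNat` of the absolute values) with the same `C, c`. -/
theorem stub_octantReduction : FirstOctantTubeFloor → TightTubeFloor :=
  Summit.CriticalPhenomena.SAWScalingLimit.Theorems.TubeLowerBound.LiebSimonStar.stub_octantReduction  -- LANDED (wave 1)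

/-- **S5 `stub_quarterFlux`** — `QuarterFlux` (LEAD RESHAPE: registered; provable now, M).  Route: first prove
`LiebSimonFloor` — cut every SAW from `0` of length `n ≥ (2R−1)²` at its first exit of the open box `‖·‖∞ < R`
(the prefix is a first-exit walk `π`, the suffix translated to `0` is an arbitrary SAW of length `n − |π|`; the map is
injective), so `c_n ≤ Σ_π c_{n−|π|}`; with `a_n := c_n x_c^n ≥ 1` (`Zd.pow_connectiveConstant_le_count`,
`criticalFugacity = (connectiveConstant 2)⁻¹`) this reads `a_n ≤ Σ_π x_c^{|π|} a_{n−|π|} ≤ θ · max_{n−(2R−1)² ≤ m < n} a_m`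
where `θ` is the first-exit mass; if `θ < 1` then by induction `a_n ≤ θ^{⌊n/M⌋} · max_{m<M} a_m → 0` (`M = (2R−1)²`),
contradicting `a_n ≥ 1`.  Then `QuarterFlux`: the four side families (exit through `x = R`, `x = −R`, `y = R`, `y = −R`)
cover the first-exit walks and have equal partial sums by the order-4 rotation `(x, y) ↦ (−y, x)` of `ℤ²` (a graph
automorphism fixing `0` and the box; transport `Zd.saws` along it as in `Zd.neg_mem_sawFun`), so each is `≥ 1/4`.
Exact enumeration (triage): `θ₁ = 4 x_c = 1.516`, `θ₂ = 1.784`, `θ₃ = 1.979`, east share `= 1/4` of `θ_R`. -/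
theorem stub_quarterFlux : QuarterFlux :=
  Summit.CriticalPhenomena.SAWScalingLimit.Theorems.TubeLowerBound.LiebSimonStar.stub_quarterFlux  -- LANDED (wave 1)

/-- **S6 `stub_dominoFloor`** — `QuarterFlux → DominoFloor` (LEAD RESHAPE: registered; Madras–Slade Lemma 4.1.12
reflect-and-Schwarz on the east fan; provable now, M).  Given `R ≥ 1`, let `E(y)` be the partial `x_c`-mass (lengths
`≤ (2R−1)²`) of first-exit walks of the open `R`-box leaving through `x = R` at height `y` (`|y| ≤ R − 1`, since the
previous vertex has `‖·‖∞ ≤ R − 1`); `Σ_y E(y) ≥ 1/4`.  For two such walks `ω, ω'` with the same exit height `y`, the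
walk `ω`, the edge `(R, y) → (R+1, y)`, then the time-reversed image of `ω'` under `x ↦ 2R + 1 − x` is a self-avoiding
walk `0 → (2R+1, 0)` (halves in the columns `x ≤ R` and `x ≥ R + 1`), of length `|ω| + |ω'| + 1 ≤ 2(2R−1)² + 1`, all of
whose vertices lie in `[−R+1, 3R] × [−R+1, R−1]`; the map `(ω, ω') ↦` glued walk is injective (cut at the unique edge
crossing `x = R + ½`).  Hence the domino sum is `≥ x_c Σ_y E(y)² ≥ x_c (Σ_y E(y))² / (2R − 1) ≥ x_c / (16 (2R+1))`
(`sq_sum_le_card_mul_sum_sq` or `Finset.inner_mul_le_norm_mul_norm`).  Tree tools: `Zd.reflAt 0 (2R+1)`,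
`zdGraph_adj_reflAt`, `Zd.mem_sawFun`, walk reversal by hand (`fun i => ω' (m - i)`). -/
theorem stub_dominoFloor : QuarterFlux → DominoFloor :=
  Summit.CriticalPhenomena.SAWScalingLimit.Theorems.TubeLowerBound.LiebSimonStar.stub_dominoFloor  -- LANDED (wave 1)

/-! ## Proved glue -/

/-- The critical fugacity is nonnegative (`x_c = 1/μ`, `μ ≥ 1`). [folklore] -/
theorem criticalFugacity_nonneg : 0 ≤ criticalFugacity := by
  have h := Zd.connectiveConstant_pos 2
  rw [Zd.connectiveConstant_two] at h
  unfold criticalFugacity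
  exact inv_nonneg.2 h.le

/-- `OneSidedReach` is formally stronger than the `K = 1` instance of the corner-crossing floor's conclusion (the flat
box `[0, X] × [0, X/5]` sits inside `[0, X] × [0, X]`): the content of S2 is the converse direction, the aspect upgrade.
Recorded to make the costume test mechanical (S2 is not a restatement). [folklore] -/
theorem cornerCrossing_one_of_oneSidedReach (h : OneSidedReach) :
    ∃ C c : ℝ, 0 ≤ C ∧ 0 < c ∧ ∀ a : ℕ, 1 ≤ a → ∃ N : ℕ,
      c * (a : ℝ) ^ (-C) ≤ ∑ n ∈ Finset.range (N + 1),
        ∑ _ω ∈ (Zd.saws 2 n).filter (fun ω =>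
            (∀ i ≤ n, 0 ≤ ω i 0 ∧ ω i 0 ≤ (a : ℤ) ∧ 0 ≤ ω i 1 ∧ ω i 1 ≤ (1 : ℤ) * a) ∧ ω n 0 = (a : ℤ)),
          criticalFugacity ^ n := by
  obtain ⟨C, c, hC, hc, h⟩ := h
  refine ⟨C, c, hC, hc, fun a ha => ?_⟩
  obtain ⟨N, hN⟩ := h a ha
  refine ⟨N, hN.trans ?_⟩
  refine Finset.sum_le_sum fun n _ => ?_
  refine Finset.sum_le_sum_of_subset_of_nonneg ?_ fun _ _ _ => pow_nonneg criticalFugacity_nonneg n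
  intro ω hω
  rw [Finset.mem_filter] at hω ⊢
  refine ⟨hω.1, fun i hi => ?_, hω.2.2⟩
  obtain ⟨h0, h1, h2, h3⟩ := hω.2.1 i hi
  exact ⟨h0, h1, h2, by linarith⟩

/-! ## The composition: stubs S1–S4b–S4a give the crux BY NAME; S5–S6 give the by-product `DominoFloor` -/

/-- **`TubeLowerBound` from the line `lieb-simon-star`** (kernel-checked, no `sorry` of its own): the corner-crossing
floor S1 is steered into a one-sided reach (S2), pinned by one mirror (S3) into one-sided flat pieces, which the corner
staircase (S4) assembles in every direction at the scale `ℓ₀ = max(1, |u − v|)`; for `ℓ ≥ ℓ₀` the `ℓ₀`-tube lies inside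
the `ℓ`-tube and `c ℓ^{−C} ≤ c ℓ₀^{−C}` (`C ≥ 0`). -/
theorem TubeLowerBound_of : TubeLowerBound := by
  obtain ⟨C, c, hC, hc, h⟩ :=
    stub_octantReduction (stub_cornerStaircase (stub_mirrorPin (stub_steeredChain stub_cornerCrossingFloor)))
  refine ⟨C, c, hc, fun u v ℓ hℓ hd => ?_⟩
  obtain ⟨N, hN⟩ := h u v
  set ℓ₀ : ℝ := max 1 (dist (Site.toComplex u) (Site.toComplex v)) with hℓ₀
  have hℓ₀ℓ : ℓ₀ ≤ ℓ := max_le hℓ hd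
  have hℓ₀pos : 0 < ℓ₀ := lt_of_lt_of_le one_pos (le_max_left _ _)
  refine ⟨N, le_trans ?_ (hN.trans ?_)⟩
  · refine mul_le_mul_of_nonneg_left ?_ hc.le
    exact Real.rpow_le_rpow_of_nonpos hℓ₀pos hℓ₀ℓ (by linarith)
  · refine Finset.sum_le_sum fun n _ => ?_
    refine Finset.sum_le_sum_of_subset_of_nonneg ?_ fun _ _ _ => pow_nonneg criticalFugacity_nonneg n
    intro ω hω
    rw [Finset.mem_filter] at hω ⊢
    refine ⟨hω.1, fun i hi => (hω.2 i hi).trans ?_⟩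
    linarith

/-- **By-product `dominoFloor_holds`** (LEAD RESHAPE): the unconditional pointwise polynomial floor for the critical
two-point function on the axis inside a domino, `G_{x_c}(0 → (2R+1)e₁ | [−R,3R+1]×[−R,R]) ≥ x_c/(16(2R+1))`, from the two
registered Simon–Lieb stubs S5, S6.  Not consumed by `TubeLowerBound_of` (a bulk star cannot sit at a staircase corner);
it settles the consequence `Negative.twoPoint_floor` of the crux on the lattice rays in the fat tube. -/
theorem dominoFloor_holds : DominoFloor :=
  stub_dominoFloor stub_quarterFlux

/-! ## Negative knowledge checked against (landed `Theorems/TubeLowerBound/Negative/*`, imported above) -/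

/-- The refuted FIXED-WIDTH variant (tube radius not tied to `|u − v|`): every tube/box in S1–S4 widens linearly with the
span, so no stub is an instance. -/
example : ¬ (∃ C c : ℝ, 0 < c ∧ ∀ (u v : Site 2) (ℓ : ℝ), 1 ≤ ℓ →
    ∃ N : ℕ, c * ℓ ^ (-C) ≤
      Summit.CriticalPhenomena.SAWScalingLimit.Theorems.TubeLowerBound.Negative.tubeMass
        criticalFugacity u v (ℓ / 10 + 2) N) :=
  Summit.CriticalPhenomena.SAWScalingLimit.Theorems.TubeLowerBound.Negative.not_withoutDist

/-- The crux restated through the landed `tubeMass` (load-bearing module), for reference. -/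
example : TubeLowerBound ↔ ∃ C c : ℝ, 0 < c ∧ ∀ (u v : Site 2) (ℓ : ℝ), 1 ≤ ℓ →
    dist (Site.toComplex u) (Site.toComplex v) ≤ ℓ →
      ∃ N : ℕ, c * ℓ ^ (-C) ≤
        Summit.CriticalPhenomena.SAWScalingLimit.Theorems.TubeLowerBound.Negative.tubeMass
          criticalFugacity u v (ℓ / 10 + 2) N :=
  Summit.CriticalPhenomena.SAWScalingLimit.Theorems.TubeLowerBound.Negative.tubeLowerBound_iff

end Summit.CriticalPhenomena.SAWScalingLimit.Cruxes.TubeLowerBound.LiebSimonStar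

end
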